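import Summits.Ventures.PercRepro.C041ZoneOCubeZoneB
import Summits.Ventures.PercRepro.C041ZoneOCubeSkelB

/-!
# HUB CORES: the Good predicates and validity of a cube state are disjunctions over the indexed zones (p6, gen 27;
C-041.md §14 (c))

Setting of `C041ZoneOCubeZoneB`.  A bare colouring `O` is a HUB CORE (`HubCore`) when every anchor of every indexed
zone is joined to the probe by a red bare `O`-walk whose intermediate vertices are QUIET — non-terminals whose zone
carries no terminal edge (`isoSet a b O`); a quiet vertex is never deleted (`not_mem_cluster_of_isoSet`,
`not_mem_cluster_b_of_isoSet`).  For a tail-free hub core and a cube state `S`: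

* `goodA_iff_exists_zone` — `Good_a S` iff some indexed zone has a red `b`-edge at a vertex of its `REACH_Z` (the
  walk enters the zone through a non-deleted anchor; conversely the hub walk reaches that anchor avoiding `D_a`);
* `goodB_iff_exists_zone` — the mirror on side `b` (`ReachZoneB`);
* `valid_iff_exists_zone` — validity iff some indexed zone has a red terminal edge at a vertex of its `K_Z`
  (tail-free (F1)); no hub hypothesis needed.

The restriction forms (`reachZoneB_of_agree`, `reachZoneB_restrict_iff`, the mirrors of `C041ZoneSplitTransfer`) let
these be read on the zone-states `restrictZone S` — the next module sums them.
-/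

namespace PercRepro

namespace MultiGraph

open Finset ZoneZ ZoneZ.ZoneData

variable {V E : Type*} {G : MultiGraph V E} {a b c : V}

section Quiet

variable [Fintype V]

/-- A quiet vertex (a non-terminal whose zone carries no terminal edge) is never in the blue cluster of `a`. -/
theorem not_mem_cluster_of_isoSet {O S : Config E} (hsub : G.BlueSub a b O S) (hadm : ¬ G.Conn Sᶜ a b) {v : V}
    (hv : v ∈ G.isoSet a b O) : v ∉ G.cluster Sᶜ a := by
  rw [mem_cluster_compl_iff_attached a b hadm ⟨hv.1, hv.2.1⟩]
  intro h
  obtain ⟨w, hw, e, he⟩ := exists_terminal_of_attached a b hsub (Or.inl rfl) h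
  rw [mem_zone] at hw
  exact hv.2.2 ⟨w, hw, e, he⟩

/-- A quiet vertex is never in the blue cluster of `b`. -/
theorem not_mem_cluster_b_of_isoSet {O S : Config E} (hsub : G.BlueSub a b O S) (hadm : ¬ G.Conn Sᶜ a b) {v : V}
    (hv : v ∈ G.isoSet a b O) : v ∉ G.cluster Sᶜ b := by
  rw [mem_cluster_compl_iff_attached' a b hadm ⟨hv.1, hv.2.1⟩]
  intro h
  obtain ⟨w, hw, e, he⟩ := exists_terminal_of_attached a b hsub (Or.inr rfl) h
  rw [mem_zone] at hw
  exact hv.2.2 ⟨w, hw, e, he⟩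

variable (G a b c)

/-- **HUB CORE**: every anchor of every indexed zone is joined to the probe by a red bare `O`-walk whose intermediate
vertices are quiet. -/
def HubCore (O : Config E) : Prop :=
  ∀ Z : G.ZoneIdx a b c O, ∀ w ∈ Z.1, w ∈ G.BareReach a b c O →
    Relation.ReflTransGen (fun x y => G.BareAdj a b O x y ∧ (y = w ∨ y ∈ G.isoSet a b O)) c w

variable {G a b c}

/-- The zone of a vertex of `K(S)` carrying a terminal edge is an indexed zone (tail-free `O`). -/
theorem isIdxZone_zone_of_mem_bareReach {O S : Config E} (hO : G.TailFree a b c O)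
    (hS : ∀ e, G.Bare a b e → O e = true → S e = true) {w : V} (hw : w ∈ G.BareReach a b c S)
    (ht : ∃ e, G.Joins e w a ∨ G.Joins e w b) : G.IsIdxZone a b c O (G.zone a b O w) := by
  refine ⟨⟨w, rfl⟩, ?_, w, self_mem_zone a b O w, ht⟩
  rcases (mem_bareReach_iff_of_tailFree hO hS).1 hw with hK | ⟨u, hu, huw⟩
  · exact ⟨w, self_mem_zone a b O w, hK⟩
  · refine ⟨u, ?_, hu⟩
    rw [mem_zone]
    exact (blueBareConn_of_openedWalk huw).symm

/-- The hub walk to an anchor `w`, read in a cube state `S`, avoids the blue cluster of `a` when `w` does. -/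
theorem hub_walk_avoiding_a {O S : Config E} (hS : G.IsCubeState a b c O S) {w : V} (hwD : w ∉ G.cluster Sᶜ a)
    (h : Relation.ReflTransGen (fun x y => G.BareAdj a b O x y ∧ (y = w ∨ y ∈ G.isoSet a b O)) c w) :
    Relation.ReflTransGen (fun x y => G.OpenAdj S x y ∧ y ∉ G.cluster Sᶜ a) c w := by
  have hsub := blueSub_of_cube hS.1
  have hadm := hS.2.2.2.2
  refine rtg_of_imp (fun x y hxy => ⟨(bareAdj_of_bareAdj_O a b hS.1 hxy.1).openAdj, ?_⟩) h
  rcases hxy.2 with rfl | hq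
  · exact hwD
  · exact not_mem_cluster_of_isoSet hsub hadm hq

/-- The hub walk to an anchor `w`, read in a cube state `S`, avoids the blue cluster of `b` when `w` does. -/
theorem hub_walk_avoiding_b {O S : Config E} (hS : G.IsCubeState a b c O S) {w : V} (hwD : w ∉ G.cluster Sᶜ b)
    (h : Relation.ReflTransGen (fun x y => G.BareAdj a b O x y ∧ (y = w ∨ y ∈ G.isoSet a b O)) c w) :
    Relation.ReflTransGen (fun x y => G.OpenAdj S x y ∧ y ∉ G.cluster Sᶜ b) c w := by
  have hsub := blueSub_of_cube hS.1
  have hadm := hS.2.2.2.2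
  refine rtg_of_imp (fun x y hxy => ⟨(bareAdj_of_bareAdj_O a b hS.1 hxy.1).openAdj, ?_⟩) h
  rcases hxy.2 with rfl | hq
  · exact hwD
  · exact not_mem_cluster_b_of_isoSet hsub hadm hq

omit [Fintype V] in
/-- A red walk inside a zone avoiding a set is an open walk avoiding it. -/
theorem openWalk_of_redIn_avoiding {S : Config E} {Z : Finset V} {W : Set V} {u v : V}
    (h : Relation.ReflTransGen (fun x y => G.RedIn a b S Z x y ∧ y ∉ W) u v) :
    Relation.ReflTransGen (fun x y => G.OpenAdj S x y ∧ y ∉ W) u v := by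
  induction h with
  | refl => exact Relation.ReflTransGen.refl
  | tail _ hxy ih =>
    obtain ⟨⟨e, _, _, hSe, hj⟩, hyW⟩ := hxy
    exact ih.tail ⟨⟨e, hSe, hj⟩, hyW⟩

/-- **`Good_a` on a tail-free hub core is a disjunction over the indexed zones**: some zone has a red `b`-edge at a
vertex of its `REACH_Z`. -/
theorem goodA_iff_exists_zone (hc : c ≠ a ∧ c ≠ b) {O S : Config E} (hO : G.TailFree a b c O)
    (hhub : G.HubCore a b c O) (hS : G.IsCubeState a b c O S) :
    G.WalkAvoiding S (G.cluster Sᶜ a) c b ↔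
      ∃ Z : G.ZoneIdx a b c O, ∃ w, G.ReachZone a b c O S Z.1 w ∧ ∃ e, G.Joins e w b ∧ S e = true := by
  constructor
  · intro hg
    obtain ⟨w, hw, _, e, hSe, hj⟩ := exists_bareWalkAvoiding_of_goodA a b c hc hg
    have hwK : w ∈ G.BareReach a b c S := bareWalk_of_avoiding a b hw
    refine ⟨⟨G.zone a b O w, isIdxZone_zone_of_mem_bareReach hO hS.1 hwK ⟨e, Or.inr hj⟩⟩, w, ?_, e, hj, hSe⟩
    exact reachZone_of_bareWalkAvoiding a b c hO hg.1 (self_mem_zone a b O w) hw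
  · rintro ⟨Z, w, ⟨w₀, hw₀Z, hw₀K, hw₀D, hpath⟩, e, hj, hSe⟩
    have hcD : c ∉ G.cluster Sᶜ a := by
      rw [mem_cluster]
      intro h
      exact hS.2.2.1 h.symm
    refine ⟨hcD, ?_⟩
    have h1 := hub_walk_avoiding_a hS hw₀D (hhub Z w₀ hw₀Z hw₀K)
    have h2 := openWalk_of_redIn_avoiding (a := a) (b := b) hpath
    refine (h1.trans h2).tail ⟨⟨e, hSe, hj⟩, ?_⟩
    rw [mem_cluster]
    exact hS.2.2.2.2

/-- **`Good_b` on a tail-free hub core is a disjunction over the indexed zones**: some zone has a red `a`-edge at a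
vertex of its `REACH_Z` on side `b`. -/
theorem goodB_iff_exists_zone (hc : c ≠ a ∧ c ≠ b) {O S : Config E} (hO : G.TailFree a b c O)
    (hhub : G.HubCore a b c O) (hS : G.IsCubeState a b c O S) :
    G.WalkAvoiding S (G.cluster Sᶜ b) c a ↔
      ∃ Z : G.ZoneIdx a b c O, ∃ w, G.ReachZoneB a b c O S Z.1 w ∧ ∃ e, G.Joins e w a ∧ S e = true := by
  constructor
  · intro hg
    obtain ⟨w, hw, _, e, hSe, hj⟩ := exists_bareWalkAvoiding_of_goodA b a c ⟨hc.2, hc.1⟩ hg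
    rw [bareAdj_comm a b S] at hw
    have hwK : w ∈ G.BareReach a b c S := bareWalk_of_avoiding a b hw
    refine ⟨⟨G.zone a b O w, isIdxZone_zone_of_mem_bareReach hO hS.1 hwK ⟨e, Or.inl hj⟩⟩, w, ?_, e, hj, hSe⟩
    exact reachZoneB_of_bareWalkAvoiding hO hg.1 (self_mem_zone a b O w) hw
  · rintro ⟨Z, w, ⟨w₀, hw₀Z, hw₀K, hw₀D, hpath⟩, e, hj, hSe⟩
    have hcD : c ∉ G.cluster Sᶜ b := by
      rw [mem_cluster]
      intro h
      exact hS.2.2.2.1 h.symm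
    refine ⟨hcD, ?_⟩
    have h1 := hub_walk_avoiding_b hS hw₀D (hhub Z w₀ hw₀Z hw₀K)
    have h2 := openWalk_of_redIn_avoiding (a := a) (b := b) hpath
    refine (h1.trans h2).tail ⟨⟨e, hSe, hj⟩, ?_⟩
    rw [mem_cluster]
    intro h
    exact hS.2.2.2.2 h.symm

/-- **Validity on a tail-free colouring is a disjunction over the indexed zones**: some zone has a red terminal edge
at a vertex of its `K_Z`. -/
theorem valid_iff_exists_zone [Fintype E] [DecidableEq E] (hc : c ≠ a ∧ c ≠ b) (hab : ∃ e, G.Joins e a b)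
    {O S : Config E} (hO : G.TailFree a b c O) (hS : G.IsCubeState a b c O S) :
    ¬ G.RcInvalid a b c S ↔
      ∃ Z : G.ZoneIdx a b c O, ∃ w, G.KZone a b c O S Z.1 w ∧ ∃ e, S e = true ∧ (G.Joins e w a ∨ G.Joins e w b) := by
  rw [rcInvalid_iff a b c hc hab hS]
  constructor
  · intro h
    by_contra h'
    apply h
    intro w hw e hj
    by_contra hSe
    have hSe' : S e = true := by
      cases h'' : S e
      · exact absurd h'' hSe
      · rfl
    refine h' ⟨⟨G.zone a b O w, isIdxZone_zone_of_mem_bareReach hO hS.1 hw ⟨e, hj⟩⟩, w, ?_, e, hSe', hj⟩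
    exact (mem_bareReach_iff_kZone hO hS.1 (self_mem_zone a b O w)).1 hw
  · rintro ⟨Z, w, hw, e, hSe, hj⟩ h
    rw [h w (mem_bareReach_of_kZone hS.1 hw) e hj] at hSe
    exact absurd hSe (by decide)

end Quiet

section Restrict

variable [Fintype V] (hc : c ≠ a ∧ c ≠ b) (hne : a ≠ b)

include hc

/-- One direction of the transfer of `REACH_Z` on side `b` between two admissible configurations blue-below `O`
agreeing on the edges of the indexed zone `Z`. -/
theorem reachZoneB_of_agree {O S S' : Config E} (hsub : G.BlueSub a b O S) (hsub' : G.BlueSub a b O S')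
    (hadm : ¬ G.Conn Sᶜ a b) (hadm' : ¬ G.Conn S'ᶜ a b) {Z : Finset V} (hZ : G.IsIdxZone a b c O Z)
    (hagree : ∀ e, G.ZoneEdge a b Z e → S' e = S e) {w : V} (h : G.ReachZoneB a b c O S Z w) :
    G.ReachZoneB a b c O S' Z w := by
  obtain ⟨z, hZz⟩ := hZ.1
  have hdel : ∀ y ∈ Z, y ∈ G.cluster Sᶜ b ↔ y ∈ G.cluster S'ᶜ b := by
    intro y hy
    have hy' := ne_terminal_of_mem_idxZone hc hZ hy
    rw [mem_cluster_compl_iff_attached' a b hadm hy', mem_cluster_compl_iff_attached' a b hadm' hy']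
    exact attached_iff_of_agree hsub hsub' (hZz ▸ hagree) (hZz ▸ hy) (Or.inr rfl)
  obtain ⟨w₀, hw₀, hK, hw₀D, hwalk⟩ := h
  refine ⟨w₀, hw₀, hK, fun h' => hw₀D ((hdel w₀ hw₀).2 h'), ?_⟩
  induction hwalk with
  | refl => exact Relation.ReflTransGen.refl
  | @tail x y hwx hxy ih =>
    obtain ⟨⟨e, hZe, he, hSe, hj⟩, hyD⟩ := hxy
    have hy : y ∈ Z := mem_of_redIn_walk hw₀ ((redIn_walk_of_avoiding a b hwx).tail ⟨e, hZe, he, hSe, hj⟩)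
    refine ih.tail ⟨⟨e, hZe, he, ?_, hj⟩, fun h' => hyD ((hdel y hy).2 h')⟩
    rw [hagree e hZe]
    exact hSe

include hne

/-- **`REACH_Z` on side `b` transfers** between a cube state and the extension of its zone-state. -/
theorem reachZoneB_restrict_iff {O S : Config E} (hS : G.IsCubeState a b c O S) {Z : Finset V}
    (hZ : G.IsIdxZone a b c O Z) (w : V) :
    G.ReachZoneB a b c O (G.extZone a b O Z (G.restrictZone a b Z S)) Z w ↔ G.ReachZoneB a b c O S Z w := by
  have hsub := blueSub_of_cube hS.1
  have hsub' := blueSub_extZone (admZone_restrict a b c hc hne hS hZ)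
  have hadm' := (adm_extZone_restrict a b c hc hne hS hZ).2.2
  constructor
  · exact reachZoneB_of_agree hc hsub' hsub hadm' hS.2.2.2.2 hZ
      (fun e he => (extZone_restrictZone_agree Z S e he).symm)
  · exact reachZoneB_of_agree hc hsub hsub' hS.2.2.2.2 hadm' hZ (extZone_restrictZone_agree Z S)

end Restrict

end MultiGraph

end PercRepro
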